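import Mathlib
import HarnessLib

/-!
# THE FLOOR ON THE GROUP-FAR PART OF THE END GAUSSIAN CORE — step (v) (NEAR₂) of N2a for `stub_end_gaussCore` (pure real bookkeeping)
# (free-hands support of ⟨stmt-QuantumFields-24197⟩ `SwapVirialDeficit.SwapGluedStiffness`; LEAD g99 memo11c (2) ∕ w3 g67 memo-N2a(iv))

On the end Gaussian core the leader point is either GROUP-NEAR its base point (compressed displacement `D = √(2g_u²) + √(2g_z²) + √(2g_v²) ≤ r`, where the follower
determinant is matched by w3's ✓`sqrt_det_inv_slabHub_le_ref_group`) or GROUP-FAR (`D > r`).  On the far part the crude determinant bound `(2/μ_F)^{d/2}` must be paid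
for by the factor `e^{−(5b/6)·m}`, `m ≥ (three-letter floor)/55200L⁶` (w3 ✓`endGauss_three_floor`).  This file is the floor's floor there:
★ `three_floor_ge_of_groupFar` — with `g_u² = U/(1+X₀+U)`, `g_v² = V/(1+Y₀+V)`, `g_z² = W/(1+W)` and the core's localisation alternative `U < τ² ∨ 12τ² ≤ B₀`
(part (i) of the core, or w3's ✓`endGaussCore_B0_ge`), `18τ² ≤ r²` and `D > r` give `min(12τ², 1)·r²/18 ≤ B₀·g_u² + g_v² + g_z²` — uniformly in the base letters
`X₀ = x₀²`, `Y₀ = y₀²` (no `(1+x₀²)` loss: the displacement is measured in the group, memo11a).  Auxiliary: `sq_div_lt_of_lt_sqrt_two_mul`, `frac_le_self_of_nonneg`.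

HONEST LABEL: elementary; `stub_end_gaussCore` ((v), glue, plug), `stub_core_tip`, ⟨24197⟩ ∕ ⟨24194⟩ OPEN; own crux ⟨22884⟩ `LargeFieldMassRefinementTail` OPEN (blocked-on
⟨19935⟩); the Yang–Mills mass gap is NOT proved; no summit is proved by a line.  THEOREMS ONLY (0 `def`, 0 `sorry`, no instance), standard axioms.  LEAD seat ym-line-sfw-p2 g99
(cell ym-idea-1, free hands), `--supports stmt-QuantumFields-24197`.  References: [folklore].
-/

set_option autoImplicit false

noncomputable section

namespace Summit.QuantumFields.YangMills.Theorems.SwapVirialDeficit.SigmaBall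

/-- `r/3 < √(2g)` with `r ≥ 0` gives `r²/18 < g`. [folklore] -/
theorem sq_div_lt_of_lt_sqrt_two_mul {r g : ℝ} (hr : 0 ≤ r) (h : r / 3 < Real.sqrt (2 * g)) : r ^ 2 / 18 < g := by
  have h2 : (r / 3) ^ 2 < 2 * g := (Real.lt_sqrt (by positivity)).1 h
  nlinarith

/-- `U/(1+X₀+U) ≤ U` for `U, X₀ ≥ 0`. [folklore] -/
theorem frac_le_self_of_nonneg {U X0 : ℝ} (hU : 0 ≤ U) (hX0 : 0 ≤ X0) : U / (1 + X0 + U) ≤ U :=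
  div_le_self hU (by linarith)

/-- ★ **THE FLOOR ON THE GROUP-FAR PART**: `min(12τ²,1)·r²/18 ≤ B₀·U/(1+X₀+U) + V/(1+Y₀+V) + W/(1+W)` whenever the compressed displacement
`√(2U/(1+X₀+U)) + √(2W/(1+W)) + √(2V/(1+Y₀+V))` exceeds `r`, `18τ² ≤ r²`, and the core alternative `U < τ² ∨ 12τ² ≤ B₀` holds. [folklore] -/
theorem three_floor_ge_of_groupFar {τ r B₀ X0 U Y0 V W : ℝ} (hr : 0 ≤ r) (hB0 : 0 ≤ B₀) (hX0 : 0 ≤ X0) (hU : 0 ≤ U) (hY0 : 0 ≤ Y0)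
    (hV : 0 ≤ V) (hW : 0 ≤ W) (hτr : 18 * τ ^ 2 ≤ r ^ 2) (hloc : U < τ ^ 2 ∨ 12 * τ ^ 2 ≤ B₀)
    (hfar : r < Real.sqrt (2 * (U / (1 + X0 + U))) + Real.sqrt (2 * (W / (1 + W))) + Real.sqrt (2 * (V / (1 + Y0 + V)))) :
    min (12 * τ ^ 2) 1 * (r ^ 2 / 18) ≤ B₀ * (U / (1 + X0 + U)) + V / (1 + Y0 + V) + W / (1 + W) := by
  have hgU : 0 ≤ U / (1 + X0 + U) := by positivity
  have hgV : 0 ≤ V / (1 + Y0 + V) := by positivity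
  have hgW : 0 ≤ W / (1 + W) := by positivity
  have hmin1 : min (12 * τ ^ 2) 1 ≤ 1 := min_le_right _ _
  have hmin12 : min (12 * τ ^ 2) 1 ≤ 12 * τ ^ 2 := min_le_left _ _
  have hmin0 : 0 ≤ min (12 * τ ^ 2) 1 := le_min (by positivity) zero_le_one
  have hr18 : 0 ≤ r ^ 2 / 18 := by positivity
  by_cases hUc : r / 3 < Real.sqrt (2 * (U / (1 + X0 + U)))
  · -- the transverse `u`-letter is group-far: then `U ≥ g_u² > r²/18 ≥ τ²`, so the core alternative gives `12τ² ≤ B₀`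
    have hg : r ^ 2 / 18 < U / (1 + X0 + U) := sq_div_lt_of_lt_sqrt_two_mul hr hUc
    have hUbig : τ ^ 2 ≤ U := by
      have := frac_le_self_of_nonneg hU hX0
      nlinarith
    have hB : 12 * τ ^ 2 ≤ B₀ := by
      rcases hloc with h | h
      · exact absurd h (not_lt.2 hUbig)
      · exact h
    calc min (12 * τ ^ 2) 1 * (r ^ 2 / 18) ≤ 12 * τ ^ 2 * (r ^ 2 / 18) := mul_le_mul_of_nonneg_right hmin12 hr18
      _ ≤ B₀ * (U / (1 + X0 + U)) := mul_le_mul hB hg.le hr18 hB0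
      _ ≤ B₀ * (U / (1 + X0 + U)) + V / (1 + Y0 + V) + W / (1 + W) := by linarith
  · by_cases hWc : r / 3 < Real.sqrt (2 * (W / (1 + W)))
    · have hg : r ^ 2 / 18 < W / (1 + W) := sq_div_lt_of_lt_sqrt_two_mul hr hWc
      calc min (12 * τ ^ 2) 1 * (r ^ 2 / 18) ≤ 1 * (r ^ 2 / 18) := mul_le_mul_of_nonneg_right hmin1 hr18
        _ ≤ W / (1 + W) := by linarith
        _ ≤ B₀ * (U / (1 + X0 + U)) + V / (1 + Y0 + V) + W / (1 + W) := by nlinarith [mul_nonneg hB0 hgU]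
    · -- both `u` and `z` are group-near, so `v` is group-far
      have hVc : r / 3 < Real.sqrt (2 * (V / (1 + Y0 + V))) := by
        have h1 := not_lt.1 hUc
        have h2 := not_lt.1 hWc
        linarith
      have hg : r ^ 2 / 18 < V / (1 + Y0 + V) := sq_div_lt_of_lt_sqrt_two_mul hr hVc
      calc min (12 * τ ^ 2) 1 * (r ^ 2 / 18) ≤ 1 * (r ^ 2 / 18) := mul_le_mul_of_nonneg_right hmin1 hr18
        _ ≤ V / (1 + Y0 + V) := by linarith
        _ ≤ B₀ * (U / (1 + X0 + U)) + V / (1 + Y0 + V) + W / (1 + W) := by nlinarith [mul_nonneg hB0 hgU]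

/-- ★ The same floor turned into the TAIL FACTOR: for `c ≥ 0`, `e^{−c·(B₀·g_u² + g_v² + g_z²)} ≤ e^{−c·min(12τ²,1)·r²/18}` on the group-far part. [folklore] -/
theorem exp_three_floor_le_of_groupFar {τ r B₀ X0 U Y0 V W c : ℝ} (hr : 0 ≤ r) (hB0 : 0 ≤ B₀) (hX0 : 0 ≤ X0) (hU : 0 ≤ U) (hY0 : 0 ≤ Y0)
    (hV : 0 ≤ V) (hW : 0 ≤ W) (hτr : 18 * τ ^ 2 ≤ r ^ 2) (hloc : U < τ ^ 2 ∨ 12 * τ ^ 2 ≤ B₀)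
    (hfar : r < Real.sqrt (2 * (U / (1 + X0 + U))) + Real.sqrt (2 * (W / (1 + W))) + Real.sqrt (2 * (V / (1 + Y0 + V)))) (hc : 0 ≤ c) :
    Real.exp (-(c * (B₀ * (U / (1 + X0 + U)) + V / (1 + Y0 + V) + W / (1 + W)))) ≤ Real.exp (-(c * (min (12 * τ ^ 2) 1 * (r ^ 2 / 18)))) := by
  have h := three_floor_ge_of_groupFar hr hB0 hX0 hU hY0 hV hW hτr hloc hfar
  exact Real.exp_le_exp.2 (neg_le_neg (mul_le_mul_of_nonneg_left h hc))

end Summit.QuantumFields.YangMills.Theorems.SwapVirialDeficit.SigmaBall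

end
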